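import Summits.ValiantsHypothesis.ValiantsHypothesis.Theorems.MonotoneRestorationOrbitRestorationQPTermCircuitInjective
import Literature.Computability.AlgebraicComplexity.SymmetricCircuitRigidity
import HarnessLib

/-!
# The reduced term circuit IS reduced (hence rigid)

Route MonotoneRestoration, crux `OrbitRestorationQP` (stmt-ValiantsHypothesis-18293) — K3 machinery, namespace
`Summit.ValiantsHypothesis.ValiantsHypothesis.Theorems.TermCircuit`.  `circuit_isReduced`: no two gates of the
reduced term circuit of a closed universe of normal terms share label and children
(`LabelledArithCircuit.IsReduced`, file `Literature/…/SymmetricCircuitRigidity.lean`), by the case analysis over the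
six kinds of gates — node gates are decoded from their children (`…Injective.lean`), the copies
`Pl u = u + Zr`, `Sc m u = m · Pl u`, `Zr = ×(0)` are told apart from node gates by the presence of a
gadget child resp. by their arity.  Consequently the circuit is RIGID and its Dawar–Wilsenach orbits are
its designed orbits (`IsReduced.orbitSize_le`).  Everything is proved. [folklore]

## References
* A. Dawar, G. Wilsenach, *Symmetric arithmetic circuits*, ToC 21 (2025), Defs. 2.2, 3.6, 3.7, §3.3
  (`Orb`, `ORB`). [DawarWilsenach2025]
* A. Dawar, G. Wilsenach, *Symmetric circuits for rank logic*, ACM ToCL 23 (2021/22), §3 (syntactic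
  equivalence, reduced circuits, unique extensions). [DawarWilsenach2021]
* A. Dawar, B. Pago, T. Seppelt, *Symmetric algebraic circuits and homomorphism polynomials*,
  arXiv:2502.06740 (2025), §5. [DawarPagoSeppelt2025]
-/

noncomputable section

open scoped Classical

-- `Summit.ValiantsHypothesis.ValiantsHypothesis.…` is the tree's single-conjunct layout (Sub = Summit).
set_option linter.dupNamespace false

namespace Summit.ValiantsHypothesis.ValiantsHypothesis.Theorems

open Literature.Computability.AlgebraicComplexity

namespace TermCircuit

open HTerm

universe u v

variable {K : Type u} {X : Type v} [CommSemiring K] (𝒰 : Universe K X)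

/-- **The reduced term circuit is reduced**: no two gates share label and children. [folklore] -/
theorem circuit_isReduced [CharZero K] : (circuit 𝒰).IsReduced := by
  intro g g' hlab hch
  change label 𝒰 g = label 𝒰 g' at hlab
  change children 𝒰 g = children 𝒰 g' at hch
  cases g with
  | V x =>
    exact (circuit 𝒰).eq_of_label_eq _ _ (by change (label 𝒰 (Gate.V x)).IsInput; simp [label]) hlab
  | C c =>
    exact (circuit 𝒰).eq_of_label_eq _ _ (by change (label 𝒰 (Gate.C c)).IsInput; simp [label]) hlab
  | T t =>
    obtain ⟨t, ht⟩ := t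
    obtain ⟨b, l, rfl⟩ := exists_eq_node_of_mem_nodes 𝒰 ht
    have hT := mem_T_of_mem_nodes 𝒰 ht
    cases b with
    | false =>
      rw [label_T_sum 𝒰 ⟨_, ht⟩ l rfl] at hlab
      rw [children_T_sum 𝒰 ⟨_, ht⟩ l rfl] at hch
      cases g' with
      | V x => simp [label] at hlab
      | C c => simp [label] at hlab
      | T t' =>
        obtain ⟨t', ht'⟩ := t'
        obtain ⟨b', l', rfl⟩ := exists_eq_node_of_mem_nodes 𝒰 ht'
        cases b' with
        | false =>
          rw [children_T_sum 𝒰 ⟨_, ht'⟩ l' rfl] at hch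
          have := eq_of_children_sum_eq 𝒰 hT (mem_T_of_mem_nodes 𝒰 ht') hch
          subst this; rfl
        | true => rw [label_T_prod 𝒰 ⟨_, ht'⟩ l' rfl] at hlab; simp at hlab
      | Sc m u => simp [label] at hlab
      | Pl u =>
        -- `Zr` is a child of `Pl u` but not of a sum node
        have hz : Gate.Zr ∈ children 𝒰 (Gate.Pl u) := by simp [children]
        rw [← hch, List.mem_toFinset, List.mem_map] at hz
        obtain ⟨w, hw, hzw⟩ := hz
        exact absurd hzw (rep_ne_Zr 𝒰 (𝒰.closed _ _ hT w hw) (List.count_pos_iff.2 hw)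
          (𝒰.count_le l hT w))
      | Zr => simp [label] at hlab
    | true =>
      rw [label_T_prod 𝒰 ⟨_, ht⟩ l rfl] at hlab
      cases g' with
      | V x => simp [label] at hlab
      | C c => simp [label] at hlab
      | T t' =>
        obtain ⟨t', ht'⟩ := t'
        obtain ⟨b', l', rfl⟩ := exists_eq_node_of_mem_nodes 𝒰 ht'
        cases b' with
        | false => rw [label_T_sum 𝒰 ⟨_, ht'⟩ l' rfl] at hlab; simp at hlab
        | true =>
          have := eq_of_children_prod_eq 𝒰 hT (mem_T_of_mem_nodes 𝒰 ht') hch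
          subst this; rfl
      | Sc m u =>
        -- `Pl u` is a child of `Sc m u` but not of a product node
        have hz : Gate.Pl u ∈ children 𝒰 (Gate.Sc m u) := by simp [children]
        obtain ⟨a, c, rfl⟩ := List.length_eq_two.1 (𝒰.binary l hT)
        have ha : a ∈ 𝒰.T := 𝒰.closed _ _ hT a (by simp)
        have hc : c ∈ 𝒰.T := 𝒰.closed _ _ hT c (by simp)
        by_cases hac : a = c
        · subst hac
          rw [← hch, children_T_sq 𝒰 ⟨_, ht⟩ a rfl ha] at hz
          simp only [Finset.mem_insert, Finset.mem_singleton] at hz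
          rcases hz with h1 | h1
          · exact absurd h1.symm (gateOf_ne_Pl 𝒰 ha _)
          · simp at h1
        · rw [← hch, children_T_pair 𝒰 ⟨_, ht⟩ a c rfl hac] at hz
          simp only [Finset.mem_insert, Finset.mem_singleton] at hz
          rcases hz with h1 | h1
          · exact absurd h1.symm (gateOf_ne_Pl 𝒰 ha _)
          · exact absurd h1.symm (gateOf_ne_Pl 𝒰 hc _)
      | Pl u => simp [label] at hlab
      | Zr =>
        -- `Zr` has one child, a product node two
        have hz : children 𝒰 Gate.Zr = {Gate.C ⟨((0 : ℕ) : K), natCast_mem_consts 𝒰 (Nat.zero_le _)⟩} :=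
          rfl
        obtain ⟨a, c, rfl⟩ := List.length_eq_two.1 (𝒰.binary l hT)
        have ha : a ∈ 𝒰.T := 𝒰.closed _ _ hT a (by simp)
        have hc : c ∈ 𝒰.T := 𝒰.closed _ _ hT c (by simp)
        by_cases hac : a = c
        · subst hac
          rw [← hch, children_T_sq 𝒰 ⟨_, ht⟩ a rfl ha] at hz
          have : Gate.Sc ⟨1, by have := 𝒰.one_le; omega⟩ ⟨a, ha⟩ ∈
              ({Gate.C ⟨((0 : ℕ) : K), natCast_mem_consts 𝒰 (Nat.zero_le _)⟩} : Finset (Gate 𝒰)) :=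
            hz ▸ (by simp)
          simp at this
        · rw [← hch, children_T_pair 𝒰 ⟨_, ht⟩ a c rfl hac] at hz
          have h0 : gateOf 𝒰 a ∈ ({Gate.C ⟨((0 : ℕ) : K), natCast_mem_consts 𝒰 (Nat.zero_le _)⟩} :
              Finset (Gate 𝒰)) := hz ▸ (by simp)
          simp only [Finset.mem_singleton] at h0
          have hc0 : gateOf 𝒰 c ∈ ({Gate.C ⟨((0 : ℕ) : K), natCast_mem_consts 𝒰 (Nat.zero_le _)⟩} :
              Finset (Gate 𝒰)) := hz ▸ (by simp)
          simp only [Finset.mem_singleton] at hc0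
          exact absurd ((gateOf_eq_C 𝒰 ha h0).trans (gateOf_eq_C 𝒰 hc hc0).symm) hac
  | Sc m u =>
    cases g' with
    | V x => simp [label] at hlab
    | C c => simp [label] at hlab
    | T t' =>
      obtain ⟨t', ht'⟩ := t'
      obtain ⟨b', l', rfl⟩ := exists_eq_node_of_mem_nodes 𝒰 ht'
      have hT' := mem_T_of_mem_nodes 𝒰 ht'
      cases b' with
      | false => rw [label_T_sum 𝒰 ⟨_, ht'⟩ l' rfl] at hlab; simp [label] at hlab
      | true =>
        have hz : Gate.Pl u ∈ children 𝒰 (Gate.Sc m u) := by simp [children]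
        obtain ⟨a, c, rfl⟩ := List.length_eq_two.1 (𝒰.binary l' hT')
        have ha : a ∈ 𝒰.T := 𝒰.closed _ _ hT' a (by simp)
        have hc : c ∈ 𝒰.T := 𝒰.closed _ _ hT' c (by simp)
        by_cases hac : a = c
        · subst hac
          rw [hch, children_T_sq 𝒰 ⟨_, ht'⟩ a rfl ha] at hz
          simp only [Finset.mem_insert, Finset.mem_singleton] at hz
          rcases hz with h1 | h1
          · exact absurd h1.symm (gateOf_ne_Pl 𝒰 ha _)
          · simp at h1
        · rw [hch, children_T_pair 𝒰 ⟨_, ht'⟩ a c rfl hac] at hz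
          simp only [Finset.mem_insert, Finset.mem_singleton] at hz
          rcases hz with h1 | h1
          · exact absurd h1.symm (gateOf_ne_Pl 𝒰 ha _)
          · exact absurd h1.symm (gateOf_ne_Pl 𝒰 hc _)
    | Sc m' u' =>
      simp only [children] at hch
      have h1 : Gate.Pl u ∈ ({Gate.C ⟨((m' : ℕ) : K), natCast_mem_consts 𝒰 (Nat.le_of_lt_succ m'.2)⟩,
          Gate.Pl u'} : Finset (Gate 𝒰)) := hch ▸ (by simp)
      simp only [Finset.mem_insert, Finset.mem_singleton, reduceCtorEq, Gate.Pl.injEq, false_or] at h1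
      subst h1
      have h2 : Gate.C ⟨((m : ℕ) : K), natCast_mem_consts 𝒰 (Nat.le_of_lt_succ m.2)⟩ ∈
          ({Gate.C ⟨((m' : ℕ) : K), natCast_mem_consts 𝒰 (Nat.le_of_lt_succ m'.2)⟩, Gate.Pl u} :
            Finset (Gate 𝒰)) := hch ▸ (by simp)
      simp only [Finset.mem_insert, Finset.mem_singleton, Gate.C.injEq, Subtype.mk.injEq,
        reduceCtorEq, or_false] at h2
      have : (m : ℕ) = m' := by exact_mod_cast h2
      rw [Fin.ext this]
    | Pl u' => simp [label] at hlab
    | Zr =>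
      have hz : Gate.Pl u ∈ children 𝒰 (Gate.Sc m u) := by simp [children]
      rw [hch] at hz
      simp [children] at hz
  | Pl u =>
    cases g' with
    | V x => simp [label] at hlab
    | C c => simp [label] at hlab
    | T t' =>
      obtain ⟨t', ht'⟩ := t'
      obtain ⟨b', l', rfl⟩ := exists_eq_node_of_mem_nodes 𝒰 ht'
      have hT' := mem_T_of_mem_nodes 𝒰 ht'
      cases b' with
      | false =>
        have hz : Gate.Zr ∈ children 𝒰 (Gate.Pl u) := by simp [children]
        rw [hch, children_T_sum 𝒰 ⟨_, ht'⟩ l' rfl, List.mem_toFinset, List.mem_map] at hz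
        obtain ⟨w, hw, hzw⟩ := hz
        exact absurd hzw (rep_ne_Zr 𝒰 (𝒰.closed _ _ hT' w hw) (List.count_pos_iff.2 hw)
          (𝒰.count_le l' hT' w))
      | true => rw [label_T_prod 𝒰 ⟨_, ht'⟩ l' rfl] at hlab; simp [label] at hlab
    | Sc m' u' => simp [label] at hlab
    | Pl u' =>
      simp only [children] at hch
      have h1 : gateOf 𝒰 u.1 ∈ ({gateOf 𝒰 u'.1, Gate.Zr} : Finset (Gate 𝒰)) := hch ▸ (by simp)
      simp only [Finset.mem_insert, Finset.mem_singleton] at h1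
      rcases h1 with h1 | h1
      · rw [Subtype.ext (gateOf_injOn 𝒰 u.2 u'.2 h1)]
      · exact absurd h1 (gateOf_ne_Zr 𝒰 u.2)
    | Zr => simp [label] at hlab
  | Zr =>
    cases g' with
    | V x => simp [label] at hlab
    | C c => simp [label] at hlab
    | T t' =>
      obtain ⟨t', ht'⟩ := t'
      obtain ⟨b', l', rfl⟩ := exists_eq_node_of_mem_nodes 𝒰 ht'
      have hT' := mem_T_of_mem_nodes 𝒰 ht'
      cases b' with
      | false => rw [label_T_sum 𝒰 ⟨_, ht'⟩ l' rfl] at hlab; simp [label] at hlab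
      | true =>
        obtain ⟨a, c, rfl⟩ := List.length_eq_two.1 (𝒰.binary l' hT')
        have ha : a ∈ 𝒰.T := 𝒰.closed _ _ hT' a (by simp)
        have hc : c ∈ 𝒰.T := 𝒰.closed _ _ hT' c (by simp)
        by_cases hac : a = c
        · subst hac
          rw [children_T_sq 𝒰 ⟨_, ht'⟩ a rfl ha] at hch
          have : Gate.Sc ⟨1, by have := 𝒰.one_le; omega⟩ ⟨a, ha⟩ ∈ children 𝒰 (Gate.Zr) :=
            hch ▸ (by simp)
          simp [children] at this
        · rw [children_T_pair 𝒰 ⟨_, ht'⟩ a c rfl hac] at hch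
          have h0 : gateOf 𝒰 a ∈ children 𝒰 (Gate.Zr) := hch ▸ (by simp)
          have h0' : gateOf 𝒰 c ∈ children 𝒰 (Gate.Zr) := hch ▸ (by simp)
          simp only [children, Finset.mem_singleton] at h0 h0'
          exact absurd ((gateOf_eq_C 𝒰 ha h0).trans (gateOf_eq_C 𝒰 hc h0').symm) hac
    | Sc m' u' =>
      have hz : Gate.Pl u' ∈ children 𝒰 (Gate.Sc m' u') := by simp [children]
      rw [← hch] at hz
      simp [children] at hz
    | Pl u' => simp [label] at hlab
    | Zr => rfl

end TermCircuit

end Summit.ValiantsHypothesis.ValiantsHypothesis.Theorems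

end
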